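import Mathlib
import HarnessLib
import HarnessLib.Audit
import Summits.ABC.Statement
import Literature.Barriers.ABC.BakerMethodBoundsStewartTijdemanGenericProofs
import Literature.Barriers.ABC.BakerMethodBounds
import HarnessLib.Audit.Status.Attr

/-!
Route: PadicPrincipalCoreST86

CLOSED (proved) 2026-08-26T14:14:33Z by operator:999:1416551 — reason: proved:Summit.ABC.ABC.Theorems.stewartTijdeman1986_holds. The file is kept as the record of this route; refuted decls are indexed as negative knowledge (`ledger negatives`).

# Route PadicPrincipalCoreST86 — Stewart–Tijdeman's log c ≪ rad^15 from a p-adic Waldschmidt-1980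
bound for principal units

RUNG ROUTE (D-0059/D-0061, class rung, never summit credit): it suffices to show THEOREM A — a
p-adic analogue, for
rationals α_j ≡ 1 (mod p) (principal units, p odd), multiplicatively independent and Kummer-free, of
Waldschmidt's 1980
lower bound for linear forms in logarithms, with a constant C(m) ≤ c₁^m·m^(c₂ m), c₂ ≤ 10, and NO
power of p beyond
(log p)-normalised heights. Given Theorem A, three kernel-checkable reductions already proved in
staging (WP-M principal
generators, the glue to the one-prime bound with n^((c₂+2)n)·p², and the odd-prime socket) give
Stewart–Tijdeman 1986,
log c ≤ κ·rad(abc)^15, i.e. the rung leaf `stewartTijdeman1986_upperBound` = `BakerShapeBound 15 0`.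
CONDITIONAL BRIDGE
on the single open statement Theorem A (the route's rank-2 item, the cell's work package WP-A): the
crux floor is waived
honestly instead of padding a second crux; Theorem A's own split (half steps / parameter numerics)
is typable only in the
`PadicCW77.Setup` language now landing under Literature/NumberTheory/Transcendental and is filed
then (Two-layer plan).
Lean: `∃ (C : ℕ → ℝ) (r : ℕ → ℕ) (c₁ c₂ : ℝ), 1 ≤ c₁ ∧ 0 ≤ c₂ ∧ c₂ ≤ 10 ∧ (∀ m, 0 ≤ C m ∧ C m ≤ c₁ ^
m * (m : ℝ) ^ (c₂ * m)) ∧ (∀ (p : ℕ), p.Prime → p ≠ 2 → ∀ (m : ℕ) (α : Fin m → ℚ) (b : Fin m → ℤ) (V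
: Fin m → ℝ) (Vmax W : ℝ), (∀ j, α j ≠ 0 ∧ 1 ≤ padicValRat p (α j - 1)) → (∀ μ : Fin m → ℤ, ∏ j, α j
^ μ j = 1 → μ = 0) → (∀ T : Finset (Fin m), T.Nonempty → ¬ IsSquare (∏ j ∈ T, α j)) → (∀ j,
Height.logHeight₁ (α j) ≤ V j) → (∀ j, Real.log p ≤ V j) → (∀ j, V j ≤ Vmax) → b ≠ 0 → (∀ j,
Real.log (max 3 (|b j| : ℝ)) ≤ W) → (padicValRat p (∏ j, α j ^ b j - 1) : ℝ) * Real.log p ≤ C m * (∏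
j, V j) * (W + Real.log (2 * Vmax)) * Real.log (2 * Vmax) / Real.log p ^ r m)`

## Assembly
Pure logic (five lines, `glue.lean`): unpack Theorem A's witnesses (C, r, c₁, c₂ ≤ 10), feed them
with WP-M to the glue
to get (K, L, κ ≤ c₂ + 2) at every odd prime with σ = τ = τ₁ = 2, and apply the odd-prime socket
with θ = 15 ≥ κ + 3.

CLOSES_TARGET: closes rung F-A1.M1 of ABC: Literature.Barriers.ABC.stewartTijdeman1986_upperBound (D-0061; not the summit Statement) — the deciding theorem of this route concludes that registered leaf instead of the Statement decl `ABC` (class rung: servable and labelled, never counted as concluding the summit Statement).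

CONDITIONAL on Literature.Computability.AlgebraicComplexity.KoiranPortierTavenas2015.theoremA — this route is an explicit reduction to that named conjecture (D-0019: crux floor waived).

Rationale: WHY THIS LINE. Mechanism: transpose Waldschmidt's 1980 interpolation-determinant-free
auxiliary-function scheme (Cijsouw–Waldschmidt 1977
descent, as ported in the tree for the archimedean case, `Waldschmidt1980.endgame`, `CW77.Setup`) to
ℚ_p for principal
units: exp/log on the closed ball ‖a‖ ≤ p⁻¹ (p odd), Newton interpolation at integer nodes with Yu's
1989 Lemma 1.4
extrapolation (`PadicNewton.norm_tsum_le_max_of_small_jets_int`, landed), ultrametric Schwarz with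
radius √p (gain
(log p)/2 per zero, conditioning loss `condExp·log p`), p-adic Liouville by the product formula,
multiquadratic Liouville
for the half steps [Yu1989, Waldschmidt1980, CijsouwWaldschmidt1977]. The reduction of arbitrary
prime generators q_i to
principal units is done ONCE, outside the analytic core, by a Minkowski–Mahler basis of the lattice
of exponent vectors z
with ∏ q_i^(z_i) ≡ ±1 (mod p) (index ≤ p − 1; Kummer condition for free since p ≠ 2), costing
m^(2m)·p in the heights —
this is what removes Yu's p^d from the core and why c₂ + 5 ≤ 15 suffices for the 1986 exponent
[StewartTijdeman1986,
StewartYu1991]. Imported from transcendence theory (archimedean Baker method) into the p-adic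
setting with an explicit
dictionary (|·| ↦ ‖·‖_p, radius R ↦ √p, Schwarz ↦ ultrametric Schwarz, Liouville ↦ product formula).
No prior route of
this summit re-derives a Baker-method rung; the negatives index has no statement of this shape.

RANKED CRUXES. #2 TheoremA (crux) — Theorem A (WP-A): for p odd, α_j ∈ ℚ with ord_p(α_j − 1) ≥ 1,
multiplicatively independent, no non-empty sub-product a square, h(α_j) ≤ V_j, log p ≤ V_j ≤ Vmax, b
≠ 0 with log max(3,|b_j|) ≤ W: ord_p(∏ α_j^(b_j) − 1)·log p ≤ C(m)·(∏ V_j)·(W + log 2Vmax)·log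
2Vmax/(log p)^r(m), for SOME C with C(m) ≤ c₁^m·m^(c₂ m), c₂ ≤ 10, and some r (r = 0 expected; r(1)
≥ 1 is refutable). [difficulty: XL] (why it might fail: the p-free constant needs every k-step,
half-step, Siegel-count and endgame inequality of the transposed W80 scheme to close at p = 3 with
Schwarz gain (log p)/2 per zero against the conditioning loss condExp·log p; margins in the cell
table are 0.17·2^J·U with Dmax/Mmax not final.) [Yu1989, Waldschmidt1980, CijsouwWaldschmidt1977]
#9 WPM (support) — WP-M principal generators: for p odd, distinct primes q_i ≠ p, e ≠ 0 with ord_p(∏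
q_i^(e_i) − 1) ≥ 1, there are rationals α_j ≡ 1 (mod p), multiplicatively independent, Kummer-free,
and e' ≠ 0 with ∏ q_i^(e_i) = ∏ α_j^(e'_j), ∏ h(α_j) ≤ m^(2m)·p·∏ log q_i, |e'_j| ≤ m^(2m)·p·(∏ log
q_i)·max|e_i|, log p ≤ 2 h(α_j). Proved in staging (Minkowski II + Mahler + Cramer; landing chain
Summits/ABC/StewartYu/PrincipalUnitLattice* → PadicLogFormsPrincipalReduction, theorem
`Summit.ABC.StewartYu.PrincipalLattice.exists_principal_generators`). [difficulty: provable-now]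
[Yu1989, EvertseGyory2015]
#9 GlueSpec (support) — The glue: WP-M and any Theorem-A-shaped bound with envelope C(m) ≤
c₁^m·m^(c₂ m) give the one-prime bound at every odd prime with exponents (κ, σ, τ, τ₁) = (≤ c₂ + 2,
2, 2, 2). In the tree: `Summit.ABC.StewartYu.primePadicBoundAt_odd_of_principal`
(Summits/ABC/StewartYu/GluePrincipalToPrime.lean) with K = 4704, L = 32 c₁ — a one-line
instantiation. [difficulty: provable-now] [StewartYu1991, Yu1989]
#9 OddShapeSpec (support) — The odd-prime socket: the one-prime bound at the odd primes alone, with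
K ≥ 0, L ≥ 1, κ, σ ≥ 0, gives BakerShapeBound θ 0 for every θ ≥ κ + σ + 1 (no prime 2, no
archimedean input: c even forces a, b odd and c < 2b). Proved in staging
(Summits/ABC/StewartYu/PrimePadicSocketOdd.lean, `bakerShapeBound_of_oddPrime_logRadShape` +
`bakerShapeBound_zero_mono`). [difficulty: provable-now] [StewartTijdeman1986, StewartYu1991]

TWO-LAYER PLAN. Foreseen split of TheoremA once
`Literature/NumberTheory/Transcendental/PadicCW77Main.lean` and `…Assembly.lean` (the
cell's p-adic Setup language: `PadicCW77.Setup`, `ParamPack S U`, `coreBound_of_paramPack`,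
`theoremA_of_coreBound`,
`symmBound_of_coreBound`, all proved in staging) have landed: TheoremA ⇐ HalfSteps (WP-A3: `∀ S U …,
S.HalfStep …` from
the multiquadratic Liouville inequality) → ParamNumerics (WP-A4: sizes KSizes, the inequalities
KFinal (1)–(2), the Siegel
count 2·#eqs ≤ #box₀ with coefficient bound, the endgame numbers) → TheoremA, glue = the landed
composition. k = 2.

KILL CRITERIA. A refutation of TheoremA for EVERY c₂ ≤ 10 (e.g. a principal-unit family forcing a
power of p in the constant) closes the
route (close --reason refuted:TheoremA); a refutation only of c₂ ≤ 10 with some larger c₂ surviving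
pivots to door B′
(`Literature.Barriers.ABC.stewartTijdeman1986_of_primePadicBound_five_logRad`, κ + σ ≤ 27/2 at p ≥
5) or to the weaker
leaf BakerShapeBound (c₂ + 5) 0. Nothing proved elsewhere moots it except a direct formalisation of
Yu 1990/2007
(rung M3), which supersedes the rung, not the method.

NOT DECOMPOSED YET. Theorem A's interior (WP-A1 interpolation/Schwarz — landed; WP-A2 functions;
WP-A3 half steps; WP-A4 parameters; WP-A5
k-steps and assembly) is not itemised at open because its statements live in the `PadicCW77.Setup`
language that is
landing file by file under Literature/NumberTheory/Transcendental; the door-B′ variant (ApexFive →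
M1 at p ≥ 5) and the
all-primes door are recorded in the cell skeleton but are not load-bearing here and are not filed.

CHEAPEST FALSIFIER. Instantiate Theorem A at m = 1, α₀ = 1 + 2p, b₀ = 1 (V₀ = log(1+2p), W = log 3):
the left side is log p, the right side
C(1)·V₀·(W + log 2V₀)·log 2V₀/(log p)^r(1) — this kills every exponent r(1) ≥ 1 as p → ∞ (checked by
hand; hence `∃ r`,
expected r = 0) and is harmless for r = 0. Next cheapest: the k-step inequality (1) of the cell
table at p = 3, J = 0.

NUMBERS. Target constants (cell table v0.1): c₂ = 2 reachable (c₁ ≈ 2^64), giving κ = 4 in the glue;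
the rung needs only
κ + σ + 1 ≤ 15, i.e. c₂ ≤ 10. Stewart–Tijdeman 1986: log c ≤ κ·R^15 [StewartTijdeman1986,
Waldschmidt2014 §2];
Stewart–Yu 1991: κ(ε)·R^(2/3+ε); Stewart–Yu 2001: κ·R^(1/3)(log R)^3 [StewartYu2001].

DEFINITION REQUESTS. None. (The parametrised helper shapes are inlined in the items; the ε-shape
family `EpsShapeBound θ₀` with the leaves
`EpsShapeBoundFour/Three` is proposed separately to
Literature/Barriers/ABC/BakerMethodBoundsEpsShape.lean for the M1⁺ rung.)

Novelty: Searches (2026-08-25): lean search 'stewartTijdeman1986' (tree: statement + doors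
`_of_primePadicBound_logRad`, `_five_logRad`, no proof of the bound); ledger negatives --problem ABC
(no Baker-method statement); lit search "p-adic logarithmic forms principal units Waldschmidt 1980"
and lit search --hybrid "Yu p-adic linear forms in logarithms supersingular Kummer condition" (hits:
Yu1989, Yu1990, Yu1998, Yu2007, StewartYu1991, StewartYu2001 — all use Yu's general theorems with
the Kummer descent inside the analytic argument); lit galaxy search "Stewart-Tijdeman|Stewart–Yu|abc
conjecture Baker" --star all (survey hits Waldschmidt2014, EvertseGyory2015 §4.6).
Nearest prior art found: Yu1989 (Theorem 1: p-adic bound with the Kummer condition, constant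
depending on p^d) and StewartTijdeman1986 (the rung itself, via van der Poorten's p-adic estimates);
Waldschmidt1980 (the archimedean scheme transposed here).
Delta: the analytic core is run only on principal units ≡ 1 (mod p) produced once by lattice
reduction (Minkowski–Mahler, index ≤ p − 1, Kummer for free at p odd), so the p-adic W80
transposition has no p^d and no Kummer descent inside — a formalisation architecture, not a new
theorem.
Claimed grade: variant  [refs: Yu1989, Yu1990, Yu1998, Yu2007, StewartYu1991, StewartYu2001, Waldschmidt2014, EvertseGyory2015, StewartTijdeman1986, Waldschmidt1980]

Barriers (technique_class: baker-linear-forms, padic-interpolation-determinant): - technique_class: baker-linear-forms, padic-interpolation-determinant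
- Literature.Barriers.ABC.BakerMethodBounds: it does not evade it and does not try to — this is a
RUNG route inside the Baker class (closes the rung leaf stewartTijdeman1986_upperBound, exponential
in rad; class rung, never summit credit, D-0061).
- Negatives index: empty for this technique class at filing (ledger negatives --problem ABC: no
linear-forms statement).

History (route lifecycle, newest last):
- 2026-08-25T21:05:37Z · closes_target -> closes rung F-A1.M1 of ABC: Literature.Barriers.ABC.stewartTijdeman1986_upperBound (D-0061; not the summit Statement) (planner-abc-stewartyu-plan-g2-0)
- 2026-08-26T14:14:33Z · CLOSED proved — proved:Summit.ABC.ABC.Theorems.stewartTijdeman1986_holds (operator:999:1416551)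

sub-problem: ABC · status: closed(proved) · opened planner-abc-stewartyu-plan-g2-0 2026-08-25T19:26:26Z · rev 3 · ledger route-ABC-PadicPrincipalCoreST86
GENERATED by the gate from the ledger (D-0016/17). Provers cite these decls: `theorem foo : Summit.ABC.ABC.Theses.PadicPrincipalCoreST86.<Decl> := …` in Summits/ABC/ABC/Theorems/<Name>.lean.
-/

namespace Summit.ABC.ABC.Theses.PadicPrincipalCoreST86

open scoped BigOperators Topology Manifold Classical MeasureTheory ProbabilityTheory Matrix InnerProductSpace ComplexConjugate ContinuousMap
open Filter Set Function TopologicalSpace MeasureTheory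

attribute [summit_statement] _root_.ABC
attribute [summit_statement] _root_.Literature.Barriers.ABC.stewartTijdeman1986_upperBound

open Literature.Abc

/-- item stmt-ABC-18951 · crux · rank 2 · closed · proved by Summit.ABC.ABC.Theorems.padicPrincipalCoreST86_theoremA_proof @ 7cb27192b059 (prover) · by planner
why it might fail: the p-free constant needs every k-step, half-step, Siegel-count and endgame inequality of the transposed W80 scheme to close at p = 3 with Schwarz gain (log p)/2 per zero against the conditioning loss condExp·log p; margins in the cell table are 0.17·2^J·U with Dmax/Mmax not final.
sources: Yu1989, Waldschmidt1980, CijsouwWaldschmidt1977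
[crux] Theorem A (WP-A): for p odd, α_j ∈ ℚ with ord_p(α_j − 1) ≥ 1, multiplicatively independent,
no non-empty sub-product a square, h(α_j) ≤ V_j, log p ≤ V_j ≤ Vmax, b ≠ 0 with log max(3,|b_j|) ≤
W: ord_p(∏ α_j^(b_j) − 1)·log p ≤ C(m)·(∏ V_j)·(W + log 2Vmax)·log 2Vmax/(log p)^r(m), for SOME C
with C(m) ≤ c₁^m·m^(c₂ m), c₂ ≤ 10, and some r (r = 0 expected; r(1) ≥ 1 is refutable). [difficulty:
XL] -/
@[route_item "route-ABC-PadicPrincipalCoreST86", crux]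
def TheoremA : Prop :=
  ∃ (C : ℕ → ℝ) (r : ℕ → ℕ) (c₁ c₂ : ℝ), 1 ≤ c₁ ∧ 0 ≤ c₂ ∧ c₂ ≤ 10 ∧ (∀ m, 0 ≤ C m ∧ C m ≤ c₁ ^ m * (m : ℝ) ^ (c₂ * m)) ∧ (∀ (p : ℕ), p.Prime → p ≠ 2 → ∀ (m : ℕ) (α : Fin m → ℚ) (b : Fin m → ℤ) (V : Fin m → ℝ) (Vmax W : ℝ), (∀ j, α j ≠ 0 ∧ 1 ≤ padicValRat p (α j - 1)) → (∀ μ : Fin m → ℤ, ∏ j, α j ^ μ j = 1 → μ = 0) → (∀ T : Finset (Fin m), T.Nonempty → ¬ IsSquare (∏ j ∈ T, α j)) → (∀ j, Height.logHeight₁ (α j) ≤ V j) → (∀ j, Real.log p ≤ V j) → (∀ j, V j ≤ Vmax) → b ≠ 0 → (∀ j, Real.log (max 3 (|b j| : ℝ)) ≤ W) → (padicValRat p (∏ j, α j ^ b j - 1) : ℝ) * Real.log p ≤ C m * (∏ j, V j) * (W + Real.log (2 * Vmax)) * Real.log (2 * Vmax) / Real.log p ^ r m)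

/-- item stmt-ABC-18952 · support · rank 9 · closed · proved by Summit.ABC.StewartYu.PrincipalLattice.exists_principal_generators @ 446e2ffb2b48 (prover) · by planner
sources: Yu1989, EvertseGyory2015
[support] WP-M principal generators: for p odd, distinct primes q_i ≠ p, e ≠ 0 with ord_p(∏
q_i^(e_i) − 1) ≥ 1, there are rationals α_j ≡ 1 (mod p), multiplicatively independent, Kummer-free,
and e' ≠ 0 with ∏ q_i^(e_i) = ∏ α_j^(e'_j), ∏ h(α_j) ≤ m^(2m)·p·∏ log q_i, |e'_j| ≤ m^(2m)·p·(∏ log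
q_i)·max|e_i|, log p ≤ 2 h(α_j). Proved in staging (Minkowski II + Mahler + Cramer; landing chain
Summits/ABC/StewartYu/PrincipalUnitLattice* → PadicLogFormsPrincipalReduction, theorem
`Summit.ABC.StewartYu.PrincipalLattice.exists_principal_generators`). [difficulty: provable-now] -/
@[route_item "route-ABC-PadicPrincipalCoreST86", crux]
def WPM : Prop :=
  ∀ (p : ℕ), p.Prime → p ≠ 2 → ∀ (m : ℕ) (q : Fin m → ℕ), (∀ i, (q i).Prime) → Function.Injective q → (∀ i, q i ≠ p) → ∀ (e : Fin m → ℤ), e ≠ 0 → 1 ≤ padicValRat p (∏ i, (q i : ℚ) ^ e i - 1) → ∃ (α : Fin m → ℚ) (e' : Fin m → ℤ), (∀ j, α j ≠ 0 ∧ 1 ≤ padicValRat p (α j - 1)) ∧ (∀ μ : Fin m → ℤ, ∏ j, α j ^ μ j = 1 → μ = 0) ∧ (∀ T : Finset (Fin m), T.Nonempty → ¬ IsSquare (∏ j ∈ T, α j)) ∧ e' ≠ 0 ∧ ∏ i, (q i : ℚ) ^ e i = ∏ j, α j ^ e' j ∧ (∏ j, Height.logHeight₁ (α j)) ≤ (m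 : ℝ) ^ (2 * m) * p * ∏ i, Real.log (q i) ∧ (∀ j, (|e' j| : ℝ) ≤ (m : ℝ) ^ (2 * m) * p * (∏ i, Real.log (q i)) * (Finset.univ.sup fun i => (e i).natAbs)) ∧ (∀ j, Real.log p ≤ 2 * Height.logHeight₁ (α j))

/-- item stmt-ABC-18953 · support · rank 9 · closed · proved by Summit.ABC.ABC.Theorems.padicPrincipalCoreST86_glueSpec_proof @ a6e53e6b0a7f (prover) · by planner
sources: StewartYu1991, Yu1989
[support] The glue: WP-M and any Theorem-A-shaped bound with envelope C(m) ≤ c₁^m·m^(c₂ m) give the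
one-prime bound at every odd prime with exponents (κ, σ, τ, τ₁) = (≤ c₂ + 2, 2, 2, 2). In the tree:
`Summit.ABC.StewartYu.primePadicBoundAt_odd_of_principal`
(Summits/ABC/StewartYu/GluePrincipalToPrime.lean) with K = 4704, L = 32 c₁ — a one-line
instantiation. [difficulty: provable-now] -/
@[route_item "route-ABC-PadicPrincipalCoreST86", crux]
def GlueSpec : Prop :=
  (∀ (p : ℕ), p.Prime → p ≠ 2 → ∀ (m : ℕ) (q : Fin m → ℕ), (∀ i, (q i).Prime) → Function.Injective q → (∀ i, q i ≠ p) → ∀ (e : Fin m → ℤ), e ≠ 0 → 1 ≤ padicValRat p (∏ i, (q i : ℚ) ^ e i - 1) → ∃ (α : Fin m → ℚ) (e' : Fin m → ℤ), (∀ j, α j ≠ 0 ∧ 1 ≤ padicValRat p (α j - 1)) ∧ (∀ μ : Fin m → ℤ, ∏ j, α j ^ μ j = 1 → μ = 0) ∧ (∀ T : Finset (Fin m), T.Nonempty → ¬ IsSquare (∏ j ∈ T, α j)) ∧ e' ≠ 0 ∧ ∏ i, (q i : ℚ) ^ e i = ∏ j, α j ^ e' j ∧ (∏ j, Height.logHeight₁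 (α j)) ≤ (m : ℝ) ^ (2 * m) * p * ∏ i, Real.log (q i) ∧ (∀ j, (|e' j| : ℝ) ≤ (m : ℝ) ^ (2 * m) * p * (∏ i, Real.log (q i)) * (Finset.univ.sup fun i => (e i).natAbs)) ∧ (∀ j, Real.log p ≤ 2 * Height.logHeight₁ (α j))) → ∀ (C : ℕ → ℝ) (r : ℕ → ℕ) (c₁ c₂ : ℝ), 1 ≤ c₁ → 0 ≤ c₂ → (∀ m, 0 ≤ C m ∧ C m ≤ c₁ ^ m * (m : ℝ) ^ (c₂ * m)) → (∀ (p : ℕ), p.Prime → p ≠ 2 → ∀ (m : ℕ) (α : Fin m → ℚ) (b : Fin m → ℤ) (V : Fin m → ℝ) (Vmax W : ℝ), (∀ j, α j ≠ 0 ∧ 1 ≤ padicValRat p (α j - 1)) → (∀ μ : Fin m → ℤ, ∏ j, α j ^ μ j = 1 → μ = 0) → (∀ T : Finset (Fin m), T.Nonempty → ¬ IsSquare (∏ j ∈ T, α j)) → (∀ j, Height.logHeight₁ (α j) ≤ V j) → (∀ j, Real.log p ≤ V j) → (∀ j, V j ≤ Vmax) → b ≠ 0 → (∀ j, Real.log (max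 3 (|b j| : ℝ)) ≤ W) → (padicValRat p (∏ j, α j ^ b j - 1) : ℝ) * Real.log p ≤ C m * (∏ j, V j) * (W + Real.log (2 * Vmax)) * Real.log (2 * Vmax) / Real.log p ^ r m) → ∃ (K L κ : ℝ), 0 ≤ K ∧ 1 ≤ L ∧ 0 ≤ κ ∧ κ ≤ c₂ + 2 ∧ ∀ p, p.Prime → p ≠ 2 → (∀ (n : ℕ) (q : Fin n → ℕ) (e : Fin n → ℤ), (∀ i, (q i).Prime) → Function.Injective q → (∀ i, q i ≠ p) → e ≠ 0 → ∏ i, ((q i : ℚ)) ^ e i ≠ 1 → (padicValRat p (∏ i, ((q i : ℚ)) ^ e i - 1) : ℝ) ≤ K * L ^ n * (n : ℝ) ^ (κ * n) * (p : ℝ) ^ (2:ℝ) * (∏ i, Real.log (q i)) * Real.log (max 3 ((Finset.univ.sup fun i => (e i).natAbs : ℕ) : ℝ)) ^ (2:ℕ) * Real.log (max 3 (∏ i, ((q i : ℕ) : ℝ))) ^ (2:ℕ))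

/-- item stmt-ABC-18954 · support · rank 9 · closed · proved by Summit.ABC.ABC.Theorems.padicPrincipalCoreST86_oddShapeSpec_proof @ 5d8f60b3aeb7 (prover) · by planner
sources: StewartTijdeman1986, StewartYu1991
[support] The odd-prime socket: the one-prime bound at the odd primes alone, with K ≥ 0, L ≥ 1, κ, σ
≥ 0, gives BakerShapeBound θ 0 for every θ ≥ κ + σ + 1 (no prime 2, no archimedean input: c even
forces a, b odd and c < 2b). Proved in staging (Summits/ABC/StewartYu/PrimePadicSocketOdd.lean,
`bakerShapeBound_of_oddPrime_logRadShape` + `bakerShapeBound_zero_mono`). [difficulty: provable-now] -/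
@[route_item "route-ABC-PadicPrincipalCoreST86", crux]
def OddShapeSpec : Prop :=
  ∀ (K L κ σ θ : ℝ) (τ τ₁ : ℕ), 0 ≤ K → 1 ≤ L → 0 ≤ κ → 0 ≤ σ → κ + σ + 1 ≤ θ → (∀ p, p.Prime → p ≠ 2 → (∀ (n : ℕ) (q : Fin n → ℕ) (e : Fin n → ℤ), (∀ i, (q i).Prime) → Function.Injective q → (∀ i, q i ≠ p) → e ≠ 0 → ∏ i, ((q i : ℚ)) ^ e i ≠ 1 → (padicValRat p (∏ i, ((q i : ℚ)) ^ e i - 1) : ℝ) ≤ K * L ^ n * (n : ℝ) ^ (κ * n) * (p : ℝ) ^ σ * (∏ i, Real.log (q i)) * Real.log (max 3 ((Finset.univ.sup fun i => (e i).natAbs : ℕ) : ℝ)) ^ τ * Real.log (max 3 (∏ i, ((q i : ℕ) : ℝ))) ^ τ₁)) → Literature.Barriers.ABC.BakerShapeBound θ 0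

/-- item stmt-ABC-19016 · aside · rank 9 · closed · moot by None · by planner
why it might fail: c₂ = 2 leaves margins of only 0.17·2^J·U in the half-step inequality at p = 3 (cell table v0.1, λ ∈ [0.70, 1.67]); a lost constant in Dmax/Mmax (not final) or in the conditioning pushes c₂ to 3, which gives only rad^(5+ε).
sources: Yu1989, Waldschmidt1980, CijsouwWaldschmidt1977
[aside] Theorem A with the cap c₂ ≤ 2 (constant C(m) ≤ c₁^m·m^(2m)): the strengthening of TheoremA
on which the sibling rung route PadicPrincipalCoreRadFour (log c ≪_ε rad^(4+ε), leaf
EpsShapeBoundFour) is conditional. Banked here (kind aside: never staffed from this route, not in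
the cone of closes) so that the shared item exists in the tree; TheoremATwo → TheoremA is immediate
(c₂ ≤ 2 ≤ 10). -/
@[route_item "route-ABC-PadicPrincipalCoreST86"]
def TheoremATwo : Prop :=
  ∃ (C : ℕ → ℝ) (r : ℕ → ℕ) (c₁ c₂ : ℝ), 1 ≤ c₁ ∧ 0 ≤ c₂ ∧ c₂ ≤ 2 ∧ (∀ m, 0 ≤ C m ∧ C m ≤ c₁ ^ m * (m : ℝ) ^ (c₂ * m)) ∧ (∀ (p : ℕ), p.Prime → p ≠ 2 → ∀ (m : ℕ) (α : Fin m → ℚ) (b : Fin m → ℤ) (V : Fin m → ℝ) (Vmax W : ℝ), (∀ j, α j ≠ 0 ∧ 1 ≤ padicValRat p (α j - 1)) → (∀ μ : Fin m → ℤ, ∏ j, α j ^ μ j = 1 → μ = 0) → (∀ T : Finset (Fin m), T.Nonempty → ¬ IsSquare (∏ j ∈ T, α j)) → (∀ j, Height.logHeight₁ (α j) ≤ V j) → (∀ j, Real.log p ≤ V j) → (∀ j, V j ≤ Vmax) → b ≠ 0 → (∀ j, Real.log (max 3 (|b j| : ℝ)) ≤ W) → (padicValRat p (∏ j, α j ^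 b j - 1) : ℝ) * Real.log p ≤ C m * (∏ j, V j) * (W + Real.log (2 * Vmax)) * Real.log (2 * Vmax) / Real.log p ^ r m)

/-- item stmt-ABC-19165 · aside · rank 9 · closed · proved by Summit.ABC.ABC.Theorems.padicPrincipalCoreRadThree_theoremAOne_proof (prover) · by planner
why it might fail: c₂ = 1 is exactly the envelope 2·(2^69 m)^m ≤ (2^70)^m·m^m of U, no slack: any further m^m in the final constant (W⋆, G beyond U; an m-dependent conditioning loss condExp·log p; Dmax·Mmax budgets ∝ m^m·U) pushes c₂ past 1 and the rung back to rad^(4+ε) (restate to TheoremATwo, stmt-ABC-19016).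
sources: Yu1989, Waldschmidt1980, CijsouwWaldschmidt1977
[aside] Theorem A with the cap c₂ ≤ 1 (constant C(m) ≤ c₁^m·m^m, c₁ = 2^70): the strengthening of
TheoremA on which the sibling rung route PadicPrincipalCoreRadThree (log c ≪_ε rad^(3+ε), leaf
EpsShapeBoundThree) is conditional; c₂ = 1 is the proved envelope of the scheme's main parameter U
(2·(2^69 m)^m ≤ (2^70)^m·m^m). Banked here (kind aside: never staffed from this route, not in the
cone of closes); TheoremAOne → TheoremATwo → TheoremA are immediate (1 ≤ 2 ≤ 10). -/
@[route_item "route-ABC-PadicPrincipalCoreST86"]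
def TheoremAOne : Prop :=
  ∃ (C : ℕ → ℝ) (r : ℕ → ℕ) (c₁ c₂ : ℝ), 1 ≤ c₁ ∧ 0 ≤ c₂ ∧ c₂ ≤ 1 ∧ (∀ m, 0 ≤ C m ∧ C m ≤ c₁ ^ m * (m : ℝ) ^ (c₂ * m)) ∧ (∀ (p : ℕ), p.Prime → p ≠ 2 → ∀ (m : ℕ) (α : Fin m → ℚ) (b : Fin m → ℤ) (V : Fin m → ℝ) (Vmax W : ℝ), (∀ j, α j ≠ 0 ∧ 1 ≤ padicValRat p (α j - 1)) → (∀ μ : Fin m → ℤ, ∏ j, α j ^ μ j = 1 → μ = 0) → (∀ T : Finset (Fin m), T.Nonempty → ¬ IsSquare (∏ j ∈ T, α j)) → (∀ j, Height.logHeight₁ (α j) ≤ V j) → (∀ j, Real.log p ≤ V j) → (∀ j, V j ≤ Vmax) → b ≠ 0 → (∀ j, Real.log (max 3 (|b j| : ℝ)) ≤ W) → (padicValRat p (∏ j, α j ^ b j - 1) : ℝ) * Real.log p ≤ C m * (∏ j, V j) * (W + Real.log (2 * Vmax)) * Real.log (2 * Vmax) / Real.log p ^ r m)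

/-- item stmt-ABC-18955 · assembly · rank 1 · closed · proved by Summit.ABC.ABC.Theorems.padicPrincipalCoreST86_assembly_proof @ e3ee6eed1ac0 (prover) · by planner
sources: StewartTijdeman1986
[assembly] TheoremA → WPM → GlueSpec → OddShapeSpec → stewartTijdeman1986_upperBound (the rung leaf,
`closes_target`). -/
@[route_item "route-ABC-PadicPrincipalCoreST86"]
def Assembly : Prop :=
  TheoremA → WPM → GlueSpec → OddShapeSpec → Literature.Barriers.ABC.stewartTijdeman1986_upperBound

/-! D-0027 §2.1 — DECIDING THEOREM (planner-authored via `route open/edit --closes-file`; by planner-abc-stewartyu-plan-g2-0 2026-08-25T21:05:37Z) — ARCHIVED: route closed (proved) 2026-08-26T14:14:33Z; kept so importers keep building: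
its hypotheses are this route's items and its conclusion the registered leaf `Literature.Barriers.ABC.stewartTijdeman1986_upperBound` (rung F-A1.M1, D-0061) (glue_lint), and it elaborates with this file. -/

@[closes "route-ABC-PadicPrincipalCoreST86"] theorem closes (hA : TheoremA) (hM : WPM) (hG : GlueSpec) (hO : OddShapeSpec) :
    Literature.Barriers.ABC.stewartTijdeman1986_upperBound := by
  obtain ⟨C, r, c₁, c₂, hc₁, hc₂, hc₂10, hC, hB⟩ := hA
  obtain ⟨K, L, κ, hK, hL, hκ0, hκ, h⟩ := hG hM C r c₁ c₂ hc₁ hc₂ hC hB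
  exact hO K L κ 2 15 2 2 hK hL hκ0 (by norm_num) (by linarith) h

end Summit.ABC.ABC.Theses.PadicPrincipalCoreST86
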